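/-
Copyright: pub-rosobs cell (Resolution Observatory), carver gen 39.  Companion file; statements OURS, in
the cell's polynomial weighted-centre model `W(f)`.  Instrument — NOT a resolution theorem.
-/
import Literature.AlgebraicGeometry.Resolution.WeightedCentreStepUmbrella
import HarnessLib

/-!
# First face of `v² + u w² + z^q`: every invariant is below `(2, 3, 3)`

For `f = X_i² + X_j² X_l + X_e^q` (`i, j, l, e` distinct, spectators allowed, `q ≥ 4`, ANY
characteristic) we prove, for ALL polynomial coordinate changes:

* `umbrellaPow_inv_mem`: the coordinate centre `(X_i², X_j³, X_l³, X_e^q)` is admissible, so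
  `(2, 3, 3, q) ∈ W(f)`;
* `not_lt_of_mem_admissibleInvariants_umbrellaPow`: NO `b ∈ W(f)` is `TruncLex`-above `(2, 3, 3)` —
  the first three entries of the invariant are at most `(2, 3, 3)` (`b₁ ≤ 2`; `b₁ = 2 ⇒ b₂ ≤ 3`;
  `b₁ = 2, b₂ = 3 ⇒ b` has a third entry `≤ 3`).

This is the vertex-theorem half (`WeightedCentreVertexPreparation`, as in `isMaxInv_umbrella`): with
respect to `y = X_i`, `ν = 2`, the polyhedron has `δ = 3/2 ∉ ℕ` (vacuously `δ`-prepared) and, for `q ≥ 4`,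
`δ`-initial form `X_i² + X_j² X_l` of `τ = 3`.  Together with the second face
(`WeightedCentreSecondFace*`: `(2), (2,3), (2,3,3) ∉ W(f)` when `q` is invertible in `k`) this pins
`max W(f)` to the segment `{(2, 3, 3, c, …) : c ≥ q}`; the expected value `(2, 3, 3, q)` needs one more
lemma (`c ≤ q`, the order of the coefficient ideal along the curve `(v, w, z)`), NOT proved here.

* §4 `hironakaTau_umbrellaPow`: `τ(X_i² + X_j² X_l + X_e^q) = 4` for `q ∉ {0, 2}` over EVERY field — translation
  invariance is tested at `k[T]`-valued points (`aeval_eq_of_mem_invarianceSpace_algebra`), which sees what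
  `k`-points of a finite field cannot;
* §5 `isMaxInv_umbrellaPow_three`: for `q = 3` the whole germ is its own `δ`-initial form, `τ = 4`, and the
  vertex theorems give the COMPLETE value `max W(X_i² + X_j² X_l + X_e³) = (2, 3, 3, 3)` (any characteristic,
  spectators allowed, all polynomial automorphisms) — the first impure census shape settled in the model.

References: [AbramovichTemkinWlodarczyk2024, Thm. 5.3.1 (2) (p. 1578), §5.1];
[CossartJannsenSaito2020, Def. 8.2, Thm. 8.16, Thm. 8.22 (a)]; [Temkin2025, §1.2.2 (1)].
Statements ours (the cell's model) — NOT a resolution theorem.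
-/

open MvPolynomial

namespace Literature.AlgebraicGeometry.Resolution.WeightedBlowup

variable {k : Type*} [Field k] {N : ℕ}

/-! ## §1 The germ `X_i² + X_j² X_l + X_e^q` and its Newton data -/

section Germ

variable (k) in
/-- `X_i² + X_j² X_l + X_e^q`: the Whitney umbrella `umbrella k i j l 2 2` plus a pure power (spectators
allowed). (construction) [cite: Temkin2025, §1.2.2 (1) (p. 4)] -/
noncomputable def umbrellaPow (i j l e : Fin N) (q : ℕ) : MvPolynomial (Fin N) k :=
  umbrella k i j l 2 2 + X e ^ q

variable {i j l e : Fin N} {q : ℕ}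

/-- `umbrellaPow = X_i² + X_l X_j² + X_e^q` (the normal form used by the second-face files). (plumbing)
[cite: Temkin2025, §1.2.2 (1) (p. 4)] -/
theorem umbrellaPow_eq : umbrellaPow k i j l e q = X i ^ 2 + X l * X j ^ 2 + X e ^ q := by
  rw [umbrellaPow, umbrella]; ring

/-- The umbrella as a sum of two monomials (plumbing). [folklore] -/
private theorem umbrella_two_eq (i j l : Fin N) :
    umbrella k i j l 2 2 = monomial (Finsupp.single i 2) 1 + monomial (umbExp j l 2) 1 := by
  rw [umbrella, umbExp, X_pow_eq_monomial, X_pow_eq_monomial, ← pow_one (X l : MvPolynomial (Fin N) k),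
    X_pow_eq_monomial, monomial_mul, mul_one]

/-- The germ as a sum of three monomials (plumbing). [folklore] -/
private theorem umbrellaPow_eq_sum :
    umbrellaPow k i j l e q =
      monomial (Finsupp.single i 2) 1 + monomial (umbExp j l 2) 1 + monomial (Finsupp.single e q) 1 := by
  rw [umbrellaPow, umbrella_two_eq, X_pow_eq_monomial]

/-- Exponent bookkeeping (plumbing). [folklore] -/
private theorem umbExp_two_apply (x : Fin N) :
    umbExp j l 2 x = (if j = x then 2 else 0) + (if l = x then 1 else 0) := by
  rw [umbExp, Finsupp.add_apply, Finsupp.single_apply, Finsupp.single_apply]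

/-- The three exponents are distinct (plumbing). [folklore] -/
private theorem single_two_ne_umbExp (hil : i ≠ l) (hjl : j ≠ l) :
    Finsupp.single i 2 ≠ umbExp j l 2 := by
  intro h
  have := congrArg (fun d => d l) h
  simp only [Finsupp.single_apply, if_neg hil, umbExp_two_apply, if_neg hjl, if_true] at this
  omega

/-- The three exponents are distinct (plumbing). [folklore] -/
private theorem single_two_ne_single (hie : i ≠ e) : Finsupp.single i 2 ≠ Finsupp.single e q := by
  intro h
  have := congrArg (fun d => d i) h
  simp only [Finsupp.single_apply, if_true, if_neg (Ne.symm hie)] at this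
  omega

/-- The three exponents are distinct (plumbing). [folklore] -/
private theorem umbExp_ne_single (hle : l ≠ e) : umbExp j l 2 ≠ Finsupp.single e q := by
  intro h
  have := congrArg (fun d => d l) h
  simp only [umbExp_two_apply, if_true, Finsupp.single_apply, if_neg (Ne.symm hle)] at this
  omega

/-- Support of the germ (plumbing). [folklore] -/
private theorem mem_support_umbrellaPow {d : Fin N →₀ ℕ} (hd : d ∈ (umbrellaPow k i j l e q).support) :
    d = Finsupp.single i 2 ∨ d = umbExp j l 2 ∨ d = Finsupp.single e q := by
  rw [umbrellaPow_eq_sum] at hd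
  have h1 := support_add hd
  rw [Finset.mem_union] at h1
  rcases h1 with h1 | h1
  · have h2 := support_add h1
    rw [Finset.mem_union] at h2
    rcases h2 with h2 | h2
    · exact Or.inl (Finset.mem_singleton.1 (support_monomial_subset h2))
    · exact Or.inr (Or.inl (Finset.mem_singleton.1 (support_monomial_subset h2)))
  · exact Or.inr (Or.inr (Finset.mem_singleton.1 (support_monomial_subset h1)))

/-- Coefficients of the germ (plumbing). [folklore] -/
private theorem coeff_single_two_umbrellaPow (hil : i ≠ l) (hie : i ≠ e) (hjl : j ≠ l) :
    coeff (Finsupp.single i 2) (umbrellaPow k i j l e q) = 1 := by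
  rw [umbrellaPow_eq_sum, coeff_add, coeff_add, coeff_monomial, coeff_monomial, coeff_monomial, if_pos rfl,
    if_neg (single_two_ne_umbExp hil hjl).symm, if_neg (single_two_ne_single (q := q) hie).symm, add_zero,
    add_zero]

/-- Coefficients of the germ (plumbing). [folklore] -/
private theorem coeff_umbExp_umbrellaPow (hil : i ≠ l) (hjl : j ≠ l) (hle : l ≠ e) :
    coeff (umbExp j l 2) (umbrellaPow k i j l e q) = 1 := by
  rw [umbrellaPow_eq_sum, coeff_add, coeff_add, coeff_monomial, coeff_monomial, coeff_monomial,
    if_neg (single_two_ne_umbExp hil hjl), if_pos rfl, if_neg (umbExp_ne_single (q := q) hle).symm,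
    zero_add, add_zero]

/-- Degree of the umbrella exponent (plumbing). [folklore] -/
private theorem degree_umbExp_two (j l : Fin N) : (umbExp j l 2).degree = 3 := by
  rw [umbExp, map_add, Finsupp.degree_single, Finsupp.degree_single]

/-- **The order of `X_i² + X_j² X_l + X_e^q` is `2`** (`q ≥ 2`).
[cite: AbramovichTemkinWlodarczyk2024, §5.1 (a₁ = ord)] -/
theorem monomialOrd_umbrellaPow (hil : i ≠ l) (hie : i ≠ e) (hjl : j ≠ l) (hq : 2 ≤ q) :
    monomialOrd (fun _ => 1) (umbrellaPow k i j l e q) = 2 := by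
  apply le_antisymm
  · have hmem : Finsupp.single i 2 ∈ (umbrellaPow k i j l e q).support := by
      rw [mem_support_iff, coeff_single_two_umbrellaPow hil hie hjl]; exact one_ne_zero
    refine (monomialOrd_le_weight (fun _ => 1) hmem).trans ?_
    rw [← Finsupp.degree_eq_weight_one, Finsupp.degree_single]
    simp
  · rw [show (2 : ℕ∞) = ((2 : ℕ) : ℕ∞) from rfl, le_monomialOrd_one_iff]
    intro d hd
    rcases mem_support_umbrellaPow hd with rfl | rfl | rfl
    · rw [Finsupp.degree_single]
    · rw [degree_umbExp_two]; norm_num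
    · rw [Finsupp.degree_single]; exact hq

/-- **The initial form is `X_i²`** (`q ≠ 2`). [cite: CossartJannsenSaito2020, Def. 8.2] -/
theorem homogeneousComponent_umbrellaPow (hq : q ≠ 2) :
    homogeneousComponent 2 (umbrellaPow k i j l e q) = X i ^ 2 := by
  rw [umbrellaPow, map_add, homogeneousComponent_umbrella (by norm_num),
    homogeneousComponent_of_mem (isHomogeneous_X_pow e q), if_neg (Ne.symm hq), add_zero]

/-- `3/2` is not a natural number (plumbing). [folklore] -/
private theorem natCast_ne_three_halves (n : ℕ) : (n : ℚ) ≠ 3 / 2 := by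
  intro h
  have h2 : (2 * n : ℕ) = (3 : ℕ) := by
    have : (2 : ℚ) * n = 3 := by rw [h]; norm_num
    exact_mod_cast this
  omega

/-- **Hironaka's `δ` with respect to `X_i` is `3/2`** (`q ≥ 3`): the points of the polyhedron are `3/2`
(from `X_j² X_l`) and `q/2` (from `X_e^q`). [cite: CossartJannsenSaito2020, Def. 8.2 (1)] -/
theorem hironakaDelta_umbrellaPow (hij : i ≠ j) (hil : i ≠ l) (hie : i ≠ e) (hjl : j ≠ l)
    (hle : l ≠ e) (hq : 3 ≤ q) :
    hironakaDelta {i} 2 (umbrellaPow k i j l e q) = (((3 : ℚ) / 2 : ℚ) : WithTop ℚ) := by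
  classical
  have hbU : blockDeg {i} (umbExp j l 2) = 0 := by
    rw [blockDeg_singleton, umbExp_two_apply, if_neg (Ne.symm hij), if_neg (Ne.symm hil)]
  have hcU : coDeg {i} (umbExp j l 2) = 3 := by
    rw [coDeg_singleton, degree_umbExp_two, umbExp_two_apply, if_neg (Ne.symm hij), if_neg (Ne.symm hil)]
  apply le_antisymm
  · unfold hironakaDelta
    have hmem : umbExp j l 2 ∈ (umbrellaPow k i j l e q).support := by
      rw [mem_support_iff, coeff_umbExp_umbrellaPow hil hjl hle]; exact one_ne_zero
    refine (Finset.inf_le (Finset.mem_filter.2 ⟨hmem, ?_⟩)).trans ?_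
    · rw [hbU]; exact two_pos
    · rw [hbU, hcU]; norm_num
  · rw [le_hironakaDelta_iff]
    intro d hd hb
    rcases mem_support_umbrellaPow hd with rfl | rfl | rfl
    · rw [blockDeg_singleton, Finsupp.single_eq_same] at hb; exact (lt_irrefl _ hb).elim
    · rw [hbU, hcU]; norm_num
    · rw [blockDeg_singleton, coDeg_singleton, Finsupp.degree_single, Finsupp.single_apply,
        if_neg (Ne.symm hie), Nat.sub_zero, Nat.sub_zero]
      have : (3 : ℚ) ≤ q := by exact_mod_cast hq
      push_cast
      linarith

/-- `δ = 3/2 ∉ ℕ`, so the germ is `δ`-prepared with respect to `X_i` for free. (derived here)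
[cite: CossartJannsenSaito2020, Thm 8.22 (a) (solvable vertices are integral)] -/
theorem isDeltaPrepared_umbrellaPow (hij : i ≠ j) (hil : i ≠ l) (hie : i ≠ e) (hjl : j ≠ l)
    (hle : l ≠ e) (hq : 3 ≤ q) : IsDeltaPrepared {i} 2 (umbrellaPow k i j l e q) := by
  intro v _ hv
  exfalso
  rw [hironakaDelta_umbrellaPow hij hil hie hjl hle hq, WithTop.coe_eq_coe] at hv
  exact natCast_ne_three_halves v.degree hv

/-- **The `δ`-initial form with respect to `X_i` is the umbrella `X_i² + X_j² X_l`** (`q ≠ 3`: the power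
`X_e^q` is off the `δ`-face). (derived here) [cite: CossartJannsenSaito2020, Def. 8.2 (4) (in_δ)] -/
theorem deltaInitial_umbrellaPow (hij : i ≠ j) (hil : i ≠ l) (hie : i ≠ e) (hjl : j ≠ l)
    (hle : l ≠ e) (hq3 : q ≠ 3) :
    deltaInitial {i} 2 ((3 : ℚ) / 2) (umbrellaPow k i j l e q) = umbrella k i j l 2 2 := by
  classical
  unfold deltaInitial
  have hfilter : ((umbrellaPow k i j l e q).support.filter fun d =>
      blockDeg {i} d ≤ 2 ∧ (coDeg {i} d : ℚ) = 3 / 2 * ((2 - blockDeg {i} d : ℕ) : ℚ)) =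
      {Finsupp.single i 2, umbExp j l 2} := by
    ext d
    simp only [Finset.mem_filter, Finset.mem_insert, Finset.mem_singleton]
    constructor
    · rintro ⟨hd, hb, hc⟩
      rcases mem_support_umbrellaPow hd with rfl | rfl | rfl
      · exact Or.inl rfl
      · exact Or.inr rfl
      · exfalso
        rw [blockDeg_singleton, coDeg_singleton, Finsupp.degree_single, Finsupp.single_apply,
          if_neg (Ne.symm hie), Nat.sub_zero, Nat.sub_zero] at hc
        apply hq3
        have : (q : ℚ) = 3 := by rw [hc]; norm_num
        exact_mod_cast this
    · rintro (rfl | rfl)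
      · refine ⟨?_, ?_, ?_⟩
        · rw [mem_support_iff, coeff_single_two_umbrellaPow hil hie hjl]; exact one_ne_zero
        · rw [blockDeg_singleton, Finsupp.single_eq_same]
        · rw [blockDeg_singleton, coDeg_singleton, Finsupp.degree_single, Finsupp.single_eq_same]; norm_num
      · refine ⟨?_, ?_, ?_⟩
        · rw [mem_support_iff, coeff_umbExp_umbrellaPow hil hjl hle]; exact one_ne_zero
        · rw [blockDeg_singleton, umbExp_two_apply, if_neg (Ne.symm hij), if_neg (Ne.symm hil)]; norm_num
        · rw [blockDeg_singleton, coDeg_singleton, degree_umbExp_two, umbExp_two_apply, if_neg (Ne.symm hij),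
            if_neg (Ne.symm hil)]; norm_num
  rw [hfilter, Finset.sum_pair (single_two_ne_umbExp hil hjl), coeff_single_two_umbrellaPow hil hie hjl,
    coeff_umbExp_umbrellaPow hil hjl hle, umbrella_two_eq]

end Germ

/-! ## §2 The coordinate centre `(X_i², X_j³, X_l³, X_e^q)`: `(2, 3, 3, q) ∈ W` -/

section Centre

variable {i j l e : Fin N} {q : ℕ}

/-- The cocharacter of the coordinate centre `(X_i², X_j³, X_l³, X_e^q)`.
[cite: AbramovichTemkinWlodarczyk2024, §5.1] -/
def umbrellaPowWeights (i j l e : Fin N) (q : ℕ) : Fin N → ℚ := fun x =>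
  if x = i then 1 / 2 else if x = j ∨ x = l then 1 / 3 else if x = e then (q : ℚ)⁻¹ else 0

/-- Values of the cocharacter (plumbing). [folklore] -/
private theorem umbrellaPowWeights_i : umbrellaPowWeights i j l e q i = 1 / 2 := by
  simp [umbrellaPowWeights]

/-- Values of the cocharacter (plumbing). [folklore] -/
private theorem umbrellaPowWeights_j (hij : i ≠ j) : umbrellaPowWeights i j l e q j = 1 / 3 := by
  simp [umbrellaPowWeights, hij.symm]

/-- Values of the cocharacter (plumbing). [folklore] -/
private theorem umbrellaPowWeights_l (hil : i ≠ l) : umbrellaPowWeights i j l e q l = 1 / 3 := by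
  simp [umbrellaPowWeights, hil.symm]

/-- Values of the cocharacter (plumbing). [folklore] -/
private theorem umbrellaPowWeights_e (hie : i ≠ e) (hje : j ≠ e) (hle : l ≠ e) :
    umbrellaPowWeights i j l e q e = (q : ℚ)⁻¹ := by
  simp [umbrellaPowWeights, hie.symm, hje.symm, hle.symm]

/-- Values of the cocharacter (plumbing). [folklore] -/
private theorem umbrellaPowWeights_of_ne {x : Fin N} (h1 : x ≠ i) (h2 : x ≠ j) (h3 : x ≠ l) (h4 : x ≠ e) :
    umbrellaPowWeights i j l e q x = 0 := by
  simp [umbrellaPowWeights, h1, h2, h3, h4]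

/-- `exps` of the cocharacter is `[2, 3, 3, q]` (`q ≥ 3`). (derived here)
[cite: AbramovichTemkinWlodarczyk2024, §5.1 (invariant (a₁,…,a_k) of the centre)] -/
theorem exps_umbrellaPowWeights (hij : i ≠ j) (hil : i ≠ l) (hie : i ≠ e) (hjl : j ≠ l) (hje : j ≠ e)
    (hle : l ≠ e) (hq : 3 ≤ q) :
    exps (umbrellaPowWeights i j l e q) = [(2 : ℚ), 3, 3, (q : ℚ)] := by
  classical
  have hq0 : (q : ℚ) ≠ 0 := by positivity
  have hfilter : (Finset.univ.filter fun x => umbrellaPowWeights i j l e q x ≠ 0) = {i, j, l, e} := by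
    ext x
    simp only [Finset.mem_filter, Finset.mem_univ, true_and, Finset.mem_insert, Finset.mem_singleton]
    constructor
    · intro hx
      by_contra hne
      push Not at hne
      exact hx (umbrellaPowWeights_of_ne hne.1 hne.2.1 hne.2.2.1 hne.2.2.2)
    · rintro (rfl | rfl | rfl | rfl)
      · rw [umbrellaPowWeights_i]; norm_num
      · rw [umbrellaPowWeights_j hij]; norm_num
      · rw [umbrellaPowWeights_l hil]; norm_num
      · rw [umbrellaPowWeights_e hie hje hle]; exact inv_ne_zero hq0
  have h4 : (({i, j, l, e} : Finset (Fin N)).toList).Perm [i, j, l, e] :=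
    (Finset.toList_insert (by simp [hij, hil, hie])).trans
      (List.Perm.cons _ ((Finset.toList_insert (by simp [hjl, hje])).trans
        (List.Perm.cons _ ((Finset.toList_insert (by simp [hle])).trans
          (List.Perm.of_eq (by rw [Finset.toList_singleton]))))))
  have hperm : (exps (umbrellaPowWeights i j l e q)).Perm [(2 : ℚ), 3, 3, (q : ℚ)] := by
    unfold exps
    refine (List.perm_insertionSort _ _).trans ?_
    rw [hfilter]
    refine (h4.map _).trans (List.Perm.of_eq ?_)
    simp only [List.map_cons, List.map_nil, umbrellaPowWeights_i, umbrellaPowWeights_j hij,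
      umbrellaPowWeights_l hil, umbrellaPowWeights_e hie hje hle, inv_inv, one_div]
  have hsorted : [(2 : ℚ), 3, 3, (q : ℚ)].Pairwise (· ≤ ·) := by
    have : (3 : ℚ) ≤ q := by exact_mod_cast hq
    have h2 : (2 : ℚ) ≤ q := by linarith
    simp only [List.pairwise_cons, List.mem_cons, List.not_mem_nil, List.Pairwise.nil, forall_eq_or_imp,
      forall_eq, or_false, and_true, IsEmpty.forall_iff, implies_true]
    refine ⟨⟨by norm_num, by norm_num, h2⟩, ⟨le_rfl, this⟩, this⟩
  exact hperm.eq_of_sortedLE (exps_sorted _).sortedLE hsorted.sortedLE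

/-- The coordinate centre `(X_i², X_j³, X_l³, X_e^q)` is admissible (`Ψ = id`, `q ≠ 0`). (derived here)
[cite: AbramovichTemkinWlodarczyk2024, Lemma 5.2.10 (coordinate dependence)] -/
theorem isCentreFor_umbrellaPowWeights (hij : i ≠ j) (hil : i ≠ l) (hie : i ≠ e) (hje : j ≠ e) (hle : l ≠ e)
    (hq : q ≠ 0) :
    IsCentreFor (umbrellaPow k i j l e q) AlgEquiv.refl (umbrellaPowWeights i j l e q) := by
  have hq0 : (q : ℚ) ≠ 0 := by exact_mod_cast hq
  refine ⟨fun x => constantCoeff_X k x, fun x => ?_, fun d hd => ?_⟩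
  · unfold umbrellaPowWeights
    split_ifs
    · norm_num
    · norm_num
    · positivity
    · exact le_rfl
  · change d ∈ (umbrellaPow k i j l e q).support at hd
    rcases mem_support_umbrellaPow hd with rfl | rfl | rfl
    · rw [monomialValuation, Finsupp.sum_single_index (by simp), umbrellaPowWeights_i]; norm_num
    · rw [umbExp, monomialValuation, Finsupp.sum_add_index' (by simp) (by intros; simp [add_mul]),
        Finsupp.sum_single_index (by simp), Finsupp.sum_single_index (by simp), umbrellaPowWeights_j hij,
        umbrellaPowWeights_l hil]
      norm_num
    · rw [monomialValuation, Finsupp.sum_single_index (by simp), umbrellaPowWeights_e hie hje hle,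
        mul_inv_cancel₀ hq0]

/-- **`(2, 3, 3, q) ∈ W(X_i² + X_j² X_l + X_e^q)`** (`q ≥ 3`). (derived here)
[cite: AbramovichTemkinWlodarczyk2024, §5.1] -/
theorem umbrellaPow_inv_mem (hij : i ≠ j) (hil : i ≠ l) (hie : i ≠ e) (hjl : j ≠ l) (hje : j ≠ e)
    (hle : l ≠ e) (hq : 3 ≤ q) :
    [(2 : ℚ), 3, 3, (q : ℚ)] ∈ admissibleInvariants (umbrellaPow k i j l e q) := by
  rw [← exps_umbrellaPowWeights hij hil hie hjl hje hle hq]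
  exact exps_mem_admissibleInvariants (isCentreFor_umbrellaPowWeights hij hil hie hje hle (by omega))

end Centre

/-! ## §3 The first face: no invariant above `(2, 3, 3)` -/

section FirstFace

variable {i j l e : Fin N} {q : ℕ}

/-- Every non-zero weight contributes its inverse to `exps` (plumbing). [folklore] -/
private theorem inv_mem_exps_of_ne_zero' {γ : Fin N → ℚ} {x : Fin N} (hx : γ x ≠ 0) : (γ x)⁻¹ ∈ exps γ := by
  classical
  unfold exps
  rw [List.mem_insertionSort, List.mem_map]
  exact ⟨x, Finset.mem_toList.2 (Finset.mem_filter.2 ⟨Finset.mem_univ _, hx⟩), rfl⟩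

/-- Heads of sorted lists (plumbing). [folklore] -/
private theorem le_of_mem_of_pairwise' {a x : ℚ} {es : List ℚ} (hs : (a :: es).Pairwise (· ≤ ·))
    (hx : x ∈ a :: es) : a ≤ x := by
  rcases List.mem_cons.1 hx with rfl | hx
  · exact le_rfl
  · exact (List.pairwise_cons.1 hs).1 x hx

/-- A sorted list with an entry `≤ θ` starts with one (plumbing). [folklore] -/
private theorem head_le_of_countP_pos' {θ a : ℚ} {es : List ℚ} (hs : (a :: es).Pairwise (· ≤ ·))
    (h : 0 < (a :: es).countP fun x => decide (x ≤ θ)) : a ≤ θ := by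
  obtain ⟨x, hx, hxθ⟩ := List.countP_pos_iff.1 h
  exact (le_of_mem_of_pairwise' hs hx).trans (by simpa using hxθ)

/-- Order bookkeeping for `[a, θ, θ]` (plumbing). [folklore] -/
private theorem not_lt_triple_of_snd_lt' {a θ e₂ : ℚ} {rest : List ℚ} (h : e₂ < θ) :
    ¬ ATW.TruncLex.lt [a, θ, θ] (a :: e₂ :: rest) := by
  rw [ATW.TruncLex.cons_lt_cons, ATW.TruncLex.cons_lt_cons]
  rintro (h1 | ⟨-, h2 | ⟨h3, -⟩⟩)
  · exact lt_irrefl _ h1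
  · exact lt_asymm h h2
  · exact h.ne' h3

/-- Order bookkeeping for `[a, θ, θ]` (plumbing). [folklore] -/
private theorem not_lt_triple_of_third_le' {a θ e₃ : ℚ} {rest : List ℚ} (h : e₃ ≤ θ) :
    ¬ ATW.TruncLex.lt [a, θ, θ] (a :: θ :: e₃ :: rest) := by
  rw [ATW.TruncLex.cons_lt_cons, ATW.TruncLex.cons_lt_cons, ATW.TruncLex.cons_lt_cons]
  rintro (h1 | ⟨-, h2 | ⟨-, h3 | ⟨-, h4⟩⟩⟩)
  · exact lt_irrefl _ h1
  · exact lt_irrefl _ h2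
  · exact not_lt.2 h h3
  · exact ATW.TruncLex.not_nil_lt _ h4

/-- Counting bookkeeping for the variables of weight `≥ 1/M` (plumbing). [folklore] -/
private theorem one_add_card_le_card_filter' {γ : Fin N → ℚ} {i : Fin N} {P M : ℚ} (hP : 0 < P)
    (hPM : P ≤ M) (hM : 0 < M) (hγi : γ i = P⁻¹) :
    1 + (Finset.univ.filter fun x => x ∉ ({i} : Finset (Fin N)) ∧ γ x = M⁻¹).card ≤
      (Finset.univ.filter fun x => γ x ≠ 0 ∧ (γ x)⁻¹ ≤ M).card := by
  rw [add_comm, ← Finset.card_insert_of_notMem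
    (s := Finset.univ.filter fun x => x ∉ ({i} : Finset (Fin N)) ∧ γ x = M⁻¹) (a := i) (by simp)]
  refine Finset.card_le_card fun x hx => ?_
  rw [Finset.mem_insert] at hx
  rw [Finset.mem_filter]
  refine ⟨Finset.mem_univ _, ?_⟩
  rcases hx with rfl | hx
  · rw [hγi, inv_inv]; exact ⟨inv_ne_zero hP.ne', hPM⟩
  · rw [Finset.mem_filter] at hx
    rw [hx.2.2, inv_inv]; exact ⟨inv_ne_zero hM.ne', le_rfl⟩

/-- **First face: no invariant of `X_i² + X_j² X_l + X_e^q` is above `(2, 3, 3)`** (`q ≥ 4`, `i, j, l, e`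
distinct, spectators allowed, EVERY characteristic, ALL polynomial coordinate changes): for every
`b ∈ W(f)`, `¬ (2,3,3) <_TruncLex b` — i.e. `b₁ ≤ 2`, and `b₁ = 2 ⇒ b₂ ≤ 3`, and `(b₁, b₂) = (2, 3) ⇒ b`
has a third entry `≤ 3`.  (derived here, from the vertex theorems of `WeightedCentreVertexPreparation`
with `y = X_i`, `ν = 2`, `δ = 3/2`, `in_δ f = X_i² + X_j² X_l`, `τ(in_δ f) = 3`)
[cite: AbramovichTemkinWlodarczyk2024, Thm. 5.3.1 (2) (p. 1578) (inv = max over admissible centres)]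
[cite: CossartJannsenSaito2020, Thm 8.16 (δ-prepared polyhedron computes the invariant), Thm. 8.22 (a)] -/
theorem not_lt_of_mem_admissibleInvariants_umbrellaPow (hij : i ≠ j) (hil : i ≠ l) (hie : i ≠ e)
    (hjl : j ≠ l) (hle : l ≠ e) (hq : 4 ≤ q) {b : List ℚ}
    (hb : b ∈ admissibleInvariants (umbrellaPow k i j l e q)) :
    ¬ ATW.TruncLex.lt [(2 : ℚ), 3, 3] b := by
  classical
  set f := umbrellaPow k i j l e q with hf
  have hpδ : ((2 : ℕ) : ℚ) * ((3 : ℚ) / 2) = 3 := by norm_num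
  -- the inputs of the vertex theorems
  have hord : monomialOrd (fun _ => 1) f = 2 := monomialOrd_umbrellaPow hil hie hjl (by omega)
  have hin : homogeneousComponent 2 f = X i ^ 2 := homogeneousComponent_umbrellaPow (by omega)
  have hτ : ({i} : Finset (Fin N)).card = hironakaTau k {homogeneousComponent 2 f} := by
    rw [hin, hironakaTau_X_pow i two_ne_zero, Finset.card_singleton]
  have hFS : ∀ d ∈ (homogeneousComponent 2 f).support, ∀ x ∉ ({i} : Finset (Fin N)), d x = 0 := by
    intro d hd x hx
    rw [hin, X_pow_eq_monomial] at hd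
    have hd' := Finset.mem_singleton.1 (support_monomial_subset hd)
    rw [Finset.mem_singleton] at hx
    rw [hd', Finsupp.single_apply, if_neg (Ne.symm hx)]
  have hδ : hironakaDelta {i} 2 f = (((3 : ℚ) / 2 : ℚ) : WithTop ℚ) :=
    hironakaDelta_umbrellaPow hij hil hie hjl hle (by omega)
  have hprep : IsDeltaPrepared {i} 2 f := isDeltaPrepared_umbrellaPow hij hil hie hjl hle (by omega)
  have hδint : ∀ n : ℕ, (n : ℚ) ≠ 3 / 2 := natCast_ne_three_halves
  have hτδ : hironakaTau k {deltaInitial {i} 2 ((3 : ℚ) / 2) f} = 3 := by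
    rw [hf, deltaInitial_umbrellaPow hij hil hie hjl hle (by omega)]
    exact hironakaTau_umbrella hij hil hjl two_ne_zero two_ne_zero
  obtain ⟨Ψ, γ, h, rfl⟩ := hb
  have hsorted := exps_sorted γ
  have hγpos : ∀ x, γ x ≠ 0 → 0 < γ x := fun x hx => lt_of_le_of_ne (h.2.1 x) (Ne.symm hx)
  by_cases hle' : ∀ x, γ x ≤ ((2 : ℕ) : ℚ)⁻¹
  · -- `[2]` is a prefix of `exps γ`, and at least two entries are `≤ 3`
    obtain ⟨es, hes⟩ : ∃ es, exps γ = ((2 : ℕ) : ℚ) :: es := by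
      obtain ⟨t, ht⟩ := replicate_prefix_of_forall_le hord h hle'
      rw [← hτ, Finset.card_singleton, List.replicate_one] at ht
      exact ⟨t, ht.symm⟩
    have hcount := succ_card_le_countP_exps_of_isDeltaPrepared hord hτ hFS hprep hδ h hle'
    rw [Finset.card_singleton, hpδ, hes, List.countP_cons_of_pos (by norm_num)] at hcount
    rw [hes] at hsorted
    obtain ⟨e₂, es', rfl⟩ : ∃ e₂ es', es = e₂ :: es' := by
      cases es with
      | nil => simp at hcount
      | cons e₂ es' => exact ⟨e₂, es', rfl⟩
    have hs₂ : (e₂ :: es').Pairwise (· ≤ ·) := (List.pairwise_cons.1 hsorted).2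
    have he₂ : e₂ ≤ 3 := head_le_of_countP_pos' hs₂ (by omega)
    rw [hes, Nat.cast_two]
    by_cases heq₂ : e₂ = 3
    swap
    · exact not_lt_triple_of_snd_lt' (lt_of_le_of_ne he₂ heq₂)
    rw [heq₂] at hes hs₂ ⊢
    -- exactly one entry of `exps γ` is `≤ 2`: the variable `x₀` of weight `1/2`
    have hes' : ∀ x ∈ es', 3 ≤ x := (List.pairwise_cons.1 hs₂).1
    have hcountp : (exps γ).countP (fun x => decide (x ≤ (2 : ℚ))) = 1 := by
      rw [hes, Nat.cast_two, List.countP_cons_of_pos (by simp), List.countP_cons_of_neg (by norm_num),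
        List.countP_eq_zero.2 (fun x hx => by
          have := hes' x hx
          simp only [decide_eq_true_eq, not_le]; linarith)]
    rw [countP_exps] at hcountp
    obtain ⟨x₀, hx₀⟩ := Finset.card_eq_one.1 hcountp
    have hx₀' : γ x₀ ≠ 0 ∧ (γ x₀)⁻¹ ≤ (2 : ℚ) := by
      have : x₀ ∈ ({x₀} : Finset (Fin N)) := Finset.mem_singleton_self x₀
      rw [← hx₀, Finset.mem_filter] at this
      exact this.2
    have hγx₀ : γ x₀ = (2 : ℚ)⁻¹ := by
      refine le_antisymm (by simpa using hle' x₀) (inv_le_of_inv_le₀ (hγpos x₀ hx₀'.1) hx₀'.2)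
    have hothers : ∀ x, x ≠ x₀ → γ x ≤ (3 : ℚ)⁻¹ := by
      intro x hx
      by_cases h0 : γ x = 0
      · rw [h0]; norm_num
      have hnot : ¬ (γ x)⁻¹ ≤ (2 : ℚ) := by
        intro hle''
        apply hx
        have : x ∈ ({x₀} : Finset (Fin N)) := by
          rw [← hx₀, Finset.mem_filter]; exact ⟨Finset.mem_univ _, h0, hle''⟩
        exact Finset.mem_singleton.1 this
      have hmem := inv_mem_exps_of_ne_zero' h0
      rw [hes, List.mem_cons] at hmem
      rcases hmem with heq | hmem
      · exfalso; apply hnot; rw [heq]; norm_num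
      · exact le_inv_of_le_inv₀ (by norm_num) (le_of_mem_of_pairwise' hs₂ hmem)
    -- move `x₀` to `i` and count the variables of weight exactly `1/3`
    set π : Equiv.Perm (Fin N) := Equiv.swap i x₀ with hπ
    have h' := h.perm π
    have hπi : π i = x₀ := Equiv.swap_apply_left i x₀
    have hπne : ∀ x, x ≠ i → π x ≠ x₀ := by
      intro x hx heq
      apply hx
      apply π.injective
      rw [heq, hπi]
    have hγS : ∀ x ∈ ({i} : Finset (Fin N)), (γ ∘ π) x = ((2 : ℕ) : ℚ)⁻¹ := by
      intro x hx
      rw [Finset.mem_singleton] at hx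
      rw [hx, Function.comp_apply, hπi, hγx₀, Nat.cast_two]
    have hγle : ∀ x ∉ ({i} : Finset (Fin N)), (γ ∘ π) x ≤ (((2 : ℕ) : ℚ) * ((3 : ℚ) / 2))⁻¹ := by
      intro x hx
      rw [Finset.mem_singleton] at hx
      rw [hpδ, Function.comp_apply]
      exact hothers _ (hπne x hx)
    have hbound := hironakaTau_deltaInitial_le_of_forall_natCast_ne hord hτ hFS hprep hδ hδint h' hγS hγle
    rw [hτδ, Finset.card_singleton, hpδ] at hbound
    have hcnt : 3 ≤ (exps (γ ∘ π)).countP (fun x => decide (x ≤ (3 : ℚ))) := by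
      rw [countP_exps]
      exact hbound.trans (one_add_card_le_card_filter' (P := 2) (by norm_num) (by norm_num) (by norm_num)
        (by rw [Function.comp_apply, hπi, hγx₀]))
    rw [exps_comp_perm, hes, Nat.cast_two, List.countP_cons_of_pos (by norm_num),
      List.countP_cons_of_pos (by simp)] at hcnt
    cases es' with
    | nil => simp at hcnt
    | cons e₃ es'' =>
      have hs₃ : (e₃ :: es'').Pairwise (· ≤ ·) := (List.pairwise_cons.1 hs₂).2
      exact not_lt_triple_of_third_le' (head_le_of_countP_pos' hs₃ (by omega))
  · -- some weight exceeds `1/2`: then the head of `exps γ` is `< 2`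
    push Not at hle'
    obtain ⟨x, hx⟩ := hle'
    rw [Nat.cast_two] at hx
    have hγx : γ x ≠ 0 := (lt_trans (by norm_num) hx).ne'
    have hlt : (γ x)⁻¹ < 2 := inv_lt_of_inv_lt₀ (by norm_num) hx
    have hmem := inv_mem_exps_of_ne_zero' hγx
    obtain ⟨a, es, hes⟩ : ∃ a es, exps γ = a :: es := by
      cases hq' : exps γ with
      | nil => rw [hq'] at hmem; simp at hmem
      | cons a es => exact ⟨a, es, rfl⟩
    rw [hes] at hmem hsorted ⊢
    have ha : a < 2 := (le_of_mem_of_pairwise' hsorted hmem).trans_lt hlt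
    rw [ATW.TruncLex.cons_lt_cons]
    rintro (h1 | ⟨h2, -⟩)
    · exact lt_asymm ha h1
    · exact ha.ne' h2

/-- **Sandwich for `max W(X_i² + X_j² X_l + X_e^q)`** (`q ≥ 4`, any characteristic): `(2,3,3,q) ∈ W(f)`
and no element of `W(f)` is above `(2,3,3)`; so a maximal element of `W(f)`, being `≥ (2,3,3,q)` and not
above `(2,3,3)`, is `(2,3,3)` itself or of the form `(2,3,3,c,…)` with `c ≥ q` (and `(2,3,3) ∉ W(f)` for `q`
invertible in `k`, by the second-face files). (derived here)
[cite: AbramovichTemkinWlodarczyk2024, Thm. 5.3.1 (2) (p. 1578)] -/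
theorem umbrellaPow_inv_mem_and_not_lt (hij : i ≠ j) (hil : i ≠ l) (hie : i ≠ e) (hjl : j ≠ l)
    (hje : j ≠ e) (hle : l ≠ e) (hq : 4 ≤ q) :
    [(2 : ℚ), 3, 3, (q : ℚ)] ∈ admissibleInvariants (umbrellaPow k i j l e q) ∧
      ∀ b ∈ admissibleInvariants (umbrellaPow k i j l e q), ¬ ATW.TruncLex.lt [(2 : ℚ), 3, 3] b :=
  ⟨umbrellaPow_inv_mem hij hil hie hjl hje hle (by omega),
    fun _ hb => not_lt_of_mem_admissibleInvariants_umbrellaPow hij hil hie hjl hle hq hb⟩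

end FirstFace

/-! ## §4 `τ(X_i² + X_j² X_l + X_e^q) = 4` (translation invariance tested at `k[T]`-valued points) -/

section Tau

variable {i j l e : Fin N} {q : ℕ}

/-- A vector of the invariance space of `{F}` is a direction of translation invariance of `F` at every point
with values in ANY commutative `k`-algebra `A`: `F(y + t w) = F(y)` for `y ∈ Aⁿ`, `t ∈ A` (so over a finite field
one may test at `k[T]`-valued points). (derived here) [cite: CossartJannsenSaito2020, Def. 1.26 / Lemma 1.27
(directrix as the space of translations leaving the form invariant)] -/
theorem aeval_eq_of_mem_invarianceSpace_algebra {F : MvPolynomial (Fin N) k} {w : Fin N → k}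
    (hw : w ∈ invarianceSpace k {F}) {A : Type*} [CommRing A] [Algebra k A] (y : Fin N → A) (t : A) :
    aeval (fun x => y x + algebraMap k A (w x) * t) F = aeval y F := by
  have h := (mem_invarianceSpace_iff k).1 hw F (Set.mem_singleton F)
  have := congrArg (aeval fun o : Option (Fin N) => o.elim t y) h
  rw [translate, ← AlgHom.comp_apply, comp_aeval, aeval_rename, aeval_rename] at this
  have e1 : ((fun o : Option (Fin N) =>
      (aeval fun o : Option (Fin N) => o.elim t y) (o.elim (X none) fun x => X (some x) + C (w x) * X none)) ∘
        some) = fun x => y x + algebraMap k A (w x) * t := by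
    funext x
    simp
  have e2 : ((fun o : Option (Fin N) => o.elim t y) ∘ some) = y := by
    funext x
    simp
  rw [e1, e2] at this
  exact this

/-- Evaluation of the germ (plumbing). [folklore] -/
private theorem aeval_umbrellaPow {A : Type*} [CommSemiring A] [Algebra k A] (v : Fin N → A) :
    aeval v (umbrellaPow k i j l e q) = v i ^ 2 + v l * v j ^ 2 + v e ^ q := by
  rw [umbrellaPow_eq]; simp

/-- Variables of the germ (plumbing). [folklore] -/
private theorem vars_umbrellaPow_subset : (umbrellaPow k i j l e q).vars ⊆ {i, j, l, e} := by
  rw [umbrellaPow_eq]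
  refine (vars_add_subset _ _).trans (Finset.union_subset ((vars_add_subset _ _).trans (Finset.union_subset ?_ ?_)) ?_)
  · refine (vars_pow _ _).trans ?_
    rw [vars_X]; simp
  · refine (vars_mul _ _).trans (Finset.union_subset ?_ ((vars_pow _ _).trans ?_))
    · rw [vars_X]; simp
    · rw [vars_X]; simp
  · refine (vars_pow _ _).trans ?_
    rw [vars_X]; simp

/-- `C a · T = 0` in `k[T]` forces `a = 0` (plumbing). [folklore] -/
private theorem eq_zero_of_C_mul_X_eq_zero {a : k} (h : Polynomial.C a * Polynomial.X = (0 : Polynomial k)) :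
    a = 0 := by
  rcases mul_eq_zero.1 h with h | h
  · exact Polynomial.C_eq_zero.1 h
  · exact absurd h Polynomial.X_ne_zero

/-- **`τ(X_i² + X_j² X_l + X_e^q) = 4`** for distinct `i, j, l, e` and `q ∉ {0, 2}`, in EVERY characteristic and over
EVERY field (also finite ones): translation invariance is tested at the `k[T]`-valued points `T·w`, `e_l + T·w`,
`e_j + T·w`.  (For `q = 2` it fails in characteristic 2: `X_i² + X_e² = (X_i + X_e)²`.) (derived here)
[cite: CossartJannsenSaito2020, Def. 1.26] -/
theorem hironakaTau_umbrellaPow (hij : i ≠ j) (hil : i ≠ l) (hie : i ≠ e) (hjl : j ≠ l) (hje : j ≠ e)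
    (hle : l ≠ e) (hq0 : q ≠ 0) (hq2 : q ≠ 2) :
    hironakaTau k {umbrellaPow k i j l e q} = 4 := by
  have hcard : ({i, j, l, e} : Finset (Fin N)).card = 4 := by
    rw [Finset.card_insert_of_notMem (by simp [hij, hil, hie]), Finset.card_insert_of_notMem (by simp [hjl, hje]),
      Finset.card_insert_of_notMem (by simp [hle]), Finset.card_singleton]
  rw [← hcard]
  refine hironakaTau_singleton_eq_card vars_umbrellaPow_subset fun w hw x hx => ?_
  have h0 := aeval_eq_of_mem_invarianceSpace_algebra hw (fun _ => (0 : Polynomial k)) Polynomial.X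
  have h1 := aeval_eq_of_mem_invarianceSpace_algebra hw (Pi.single l (1 : Polynomial k)) Polynomial.X
  have h2 := aeval_eq_of_mem_invarianceSpace_algebra hw (Pi.single j (1 : Polynomial k)) Polynomial.X
  simp only [aeval_umbrellaPow, Polynomial.algebraMap_eq, zero_add, zero_pow hq0, zero_pow two_ne_zero, mul_zero,
    add_zero] at h0
  simp only [aeval_umbrellaPow, Polynomial.algebraMap_eq, Pi.single_eq_same, Pi.single_eq_of_ne hil,
    Pi.single_eq_of_ne hjl, Pi.single_eq_of_ne hle.symm, zero_add, zero_pow hq0, zero_pow two_ne_zero, mul_zero,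
    add_zero] at h1
  simp only [aeval_umbrellaPow, Polynomial.algebraMap_eq, Pi.single_eq_same, Pi.single_eq_of_ne hij,
    Pi.single_eq_of_ne hjl.symm, Pi.single_eq_of_ne hje.symm, zero_add, zero_pow hq0, zero_pow two_ne_zero, one_pow,
    zero_mul, add_zero] at h2
  -- `w_j = 0` from `h1 - h0`
  have hwj : w j = 0 := by
    have h : (Polynomial.C (w j) * Polynomial.X) ^ 2 = 0 := by linear_combination h1 - h0
    exact eq_zero_of_C_mul_X_eq_zero ((pow_eq_zero_iff two_ne_zero).1 h)
  rw [hwj, map_zero] at h0 h2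
  -- `w_i = 0` from the `T²`-coefficient of `h0` (`q ≠ 2`), then `w_e = 0` from what is left
  have h0' : Polynomial.C (w i) ^ 2 * Polynomial.X ^ 2 + Polynomial.C (w e) ^ q * Polynomial.X ^ q =
      (0 : Polynomial k) := by
    linear_combination h0
  have hwi : w i = 0 := by
    have := congrArg (fun P : Polynomial k => P.coeff 2) h0'
    simp only [← Polynomial.C_pow, Polynomial.coeff_add, Polynomial.coeff_C_mul_X_pow, Polynomial.coeff_zero,
      if_neg (Ne.symm hq2), if_true, add_zero] at this
    exact (pow_eq_zero_iff two_ne_zero).1 this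
  have hwe : w e = 0 := by
    rw [hwi, map_zero, zero_pow two_ne_zero, zero_mul, zero_add] at h0'
    rcases mul_eq_zero.1 h0' with h | h
    · exact Polynomial.C_eq_zero.1 ((pow_eq_zero_iff hq0).1 h)
    · exact absurd h (pow_ne_zero q Polynomial.X_ne_zero)
  -- `w_l = 0` from `h2`
  have hwl : w l = 0 := by
    rw [hwi, hwe, map_zero] at h2
    simp only [zero_mul, add_zero, zero_pow two_ne_zero, zero_pow hq0, one_pow, mul_one, zero_add] at h2
    exact eq_zero_of_C_mul_X_eq_zero h2
  simp only [Finset.mem_insert, Finset.mem_singleton] at hx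
  rcases hx with rfl | rfl | rfl | rfl
  exacts [hwi, hwj, hwl, hwe]

end Tau

/-! ## §5 The case `q = 3`: `max W(X_i² + X_j² X_l + X_e³) = (2, 3, 3, 3)` -/

section Three

variable {i j l e : Fin N}

/-- For `q = 3` the whole germ lies on the `δ`-face: `in_δ(X_i² + X_j² X_l + X_e³)` is the germ itself.
(derived here) [cite: CossartJannsenSaito2020, Def. 8.2 (4) (in_δ)] -/
theorem deltaInitial_umbrellaPow_three (hij : i ≠ j) (hil : i ≠ l) (hie : i ≠ e) :
    deltaInitial {i} 2 ((3 : ℚ) / 2) (umbrellaPow k i j l e 3) = umbrellaPow k i j l e 3 := by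
  refine deltaInitial_eq_self fun d hd => ?_
  rcases mem_support_umbrellaPow hd with rfl | rfl | rfl
  · rw [blockDeg_singleton, coDeg_singleton, Finsupp.degree_single, Finsupp.single_eq_same]; norm_num
  · rw [blockDeg_singleton, coDeg_singleton, degree_umbExp_two, umbExp_two_apply, if_neg (Ne.symm hij),
      if_neg (Ne.symm hil)]; norm_num
  · rw [blockDeg_singleton, coDeg_singleton, Finsupp.degree_single, Finsupp.single_apply, if_neg (Ne.symm hie)]
    norm_num

/-- Order bookkeeping for `a :: θ :: …` against a smaller second entry (plumbing). [folklore] -/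
private theorem not_lt_cons₂_of_snd_lt {a θ e₂ : ℚ} {tl rest : List ℚ} (h : e₂ < θ) :
    ¬ ATW.TruncLex.lt (a :: θ :: tl) (a :: e₂ :: rest) := by
  rw [ATW.TruncLex.cons_lt_cons, ATW.TruncLex.cons_lt_cons]
  rintro (h1 | ⟨-, h2 | ⟨h3, -⟩⟩)
  · exact lt_irrefl _ h1
  · exact lt_asymm h h2
  · exact h.ne' h3

/-- Order bookkeeping for `[a, θ, θ, θ]` (plumbing). [folklore] -/
private theorem not_lt_quad_of_le {a θ e₃ e₄ : ℚ} {rest : List ℚ} (h3 : e₃ ≤ θ) (h4 : e₄ ≤ θ) :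
    ¬ ATW.TruncLex.lt [a, θ, θ, θ] (a :: θ :: e₃ :: e₄ :: rest) := by
  rw [ATW.TruncLex.cons_lt_cons, ATW.TruncLex.cons_lt_cons, ATW.TruncLex.cons_lt_cons, ATW.TruncLex.cons_lt_cons]
  rintro (h1 | ⟨-, h2 | ⟨-, h5 | ⟨-, h7 | ⟨-, h8⟩⟩⟩⟩)
  · exact lt_irrefl _ h1
  · exact lt_irrefl _ h2
  · exact not_lt.2 h3 h5
  · exact not_lt.2 h4 h7
  · exact ATW.TruncLex.not_nil_lt _ h8

/-- **`max W(X_i² + X_j² X_l + X_e³) = (2, 3, 3, 3)`** (distinct `i, j, l, e`, spectators allowed, EVERY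
characteristic, ALL polynomial coordinate changes): the coordinate centre `(X_i², X_j³, X_l³, X_e³)` attains it,
and by the vertex theorems (`y = X_i`, `ν = 2`, `δ = 3/2 ∉ ℕ`, `in_δ f = f`, `τ(in_δ f) = 4`) every admissible
centre with all weights `≤ 1/2` and second entry `3` has at least three weights equal to `1/3`.  First complete
value of an "impure" census shape in the model. (derived here)
[cite: AbramovichTemkinWlodarczyk2024, Thm. 5.3.1 (2) (p. 1578) (inv = max over admissible centres)]
[cite: CossartJannsenSaito2020, Thm 8.16, Thm. 8.22 (a)] -/
theorem isMaxInv_umbrellaPow_three (hij : i ≠ j) (hil : i ≠ l) (hie : i ≠ e) (hjl : j ≠ l) (hje : j ≠ e)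
    (hle : l ≠ e) :
    IsMaxInv (admissibleInvariants (umbrellaPow k i j l e 3)) [(2 : ℚ), 3, 3, 3] := by
  classical
  refine ⟨?_, fun b hb => ?_⟩
  · have hm := umbrellaPow_inv_mem (k := k) hij hil hie hjl hje hle (le_refl 3)
    norm_num at hm
    exact hm
  set f := umbrellaPow k i j l e 3 with hf
  have hpδ : ((2 : ℕ) : ℚ) * ((3 : ℚ) / 2) = 3 := by norm_num
  have hord : monomialOrd (fun _ => 1) f = 2 := monomialOrd_umbrellaPow hil hie hjl (by norm_num)
  have hin : homogeneousComponent 2 f = X i ^ 2 := homogeneousComponent_umbrellaPow (by norm_num)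
  have hτ : ({i} : Finset (Fin N)).card = hironakaTau k {homogeneousComponent 2 f} := by
    rw [hin, hironakaTau_X_pow i two_ne_zero, Finset.card_singleton]
  have hFS : ∀ d ∈ (homogeneousComponent 2 f).support, ∀ x ∉ ({i} : Finset (Fin N)), d x = 0 := by
    intro d hd x hx
    rw [hin, X_pow_eq_monomial] at hd
    have hd' := Finset.mem_singleton.1 (support_monomial_subset hd)
    rw [Finset.mem_singleton] at hx
    rw [hd', Finsupp.single_apply, if_neg (Ne.symm hx)]
  have hδ : hironakaDelta {i} 2 f = (((3 : ℚ) / 2 : ℚ) : WithTop ℚ) :=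
    hironakaDelta_umbrellaPow hij hil hie hjl hle (le_refl 3)
  have hprep : IsDeltaPrepared {i} 2 f := isDeltaPrepared_umbrellaPow hij hil hie hjl hle (le_refl 3)
  have hδint : ∀ n : ℕ, (n : ℚ) ≠ 3 / 2 := natCast_ne_three_halves
  have hτδ : hironakaTau k {deltaInitial {i} 2 ((3 : ℚ) / 2) f} = 4 := by
    rw [hf, deltaInitial_umbrellaPow_three hij hil hie]
    exact hironakaTau_umbrellaPow hij hil hie hjl hje hle three_ne_zero (by norm_num)
  obtain ⟨Ψ, γ, h, rfl⟩ := hb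
  have hsorted := exps_sorted γ
  have hγpos : ∀ x, γ x ≠ 0 → 0 < γ x := fun x hx => lt_of_le_of_ne (h.2.1 x) (Ne.symm hx)
  by_cases hle' : ∀ x, γ x ≤ ((2 : ℕ) : ℚ)⁻¹
  · obtain ⟨es, hes⟩ : ∃ es, exps γ = ((2 : ℕ) : ℚ) :: es := by
      obtain ⟨t, ht⟩ := replicate_prefix_of_forall_le hord h hle'
      rw [← hτ, Finset.card_singleton, List.replicate_one] at ht
      exact ⟨t, ht.symm⟩
    have hcount := succ_card_le_countP_exps_of_isDeltaPrepared hord hτ hFS hprep hδ h hle'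
    rw [Finset.card_singleton, hpδ, hes, List.countP_cons_of_pos (by norm_num)] at hcount
    rw [hes] at hsorted
    obtain ⟨e₂, es', rfl⟩ : ∃ e₂ es', es = e₂ :: es' := by
      cases es with
      | nil => simp at hcount
      | cons e₂ es' => exact ⟨e₂, es', rfl⟩
    have hs₂ : (e₂ :: es').Pairwise (· ≤ ·) := (List.pairwise_cons.1 hsorted).2
    have he₂ : e₂ ≤ 3 := head_le_of_countP_pos' hs₂ (by omega)
    rw [hes, Nat.cast_two]
    by_cases heq₂ : e₂ = 3
    swap
    · exact not_lt_cons₂_of_snd_lt (lt_of_le_of_ne he₂ heq₂)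
    rw [heq₂] at hes hs₂ ⊢
    have hes' : ∀ x ∈ es', 3 ≤ x := (List.pairwise_cons.1 hs₂).1
    have hcountp : (exps γ).countP (fun x => decide (x ≤ (2 : ℚ))) = 1 := by
      rw [hes, Nat.cast_two, List.countP_cons_of_pos (by simp), List.countP_cons_of_neg (by norm_num),
        List.countP_eq_zero.2 (fun x hx => by
          have := hes' x hx
          simp only [decide_eq_true_eq, not_le]; linarith)]
    rw [countP_exps] at hcountp
    obtain ⟨x₀, hx₀⟩ := Finset.card_eq_one.1 hcountp
    have hx₀' : γ x₀ ≠ 0 ∧ (γ x₀)⁻¹ ≤ (2 : ℚ) := by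
      have : x₀ ∈ ({x₀} : Finset (Fin N)) := Finset.mem_singleton_self x₀
      rw [← hx₀, Finset.mem_filter] at this
      exact this.2
    have hγx₀ : γ x₀ = (2 : ℚ)⁻¹ := by
      refine le_antisymm (by simpa using hle' x₀) (inv_le_of_inv_le₀ (hγpos x₀ hx₀'.1) hx₀'.2)
    have hothers : ∀ x, x ≠ x₀ → γ x ≤ (3 : ℚ)⁻¹ := by
      intro x hx
      by_cases h0 : γ x = 0
      · rw [h0]; norm_num
      have hnot : ¬ (γ x)⁻¹ ≤ (2 : ℚ) := by
        intro hle''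
        apply hx
        have : x ∈ ({x₀} : Finset (Fin N)) := by
          rw [← hx₀, Finset.mem_filter]; exact ⟨Finset.mem_univ _, h0, hle''⟩
        exact Finset.mem_singleton.1 this
      have hmem := inv_mem_exps_of_ne_zero' h0
      rw [hes, List.mem_cons] at hmem
      rcases hmem with heq | hmem
      · exfalso; apply hnot; rw [heq]; norm_num
      · exact le_inv_of_le_inv₀ (by norm_num) (le_of_mem_of_pairwise' hs₂ hmem)
    set π : Equiv.Perm (Fin N) := Equiv.swap i x₀ with hπ
    have h' := h.perm π
    have hπi : π i = x₀ := Equiv.swap_apply_left i x₀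
    have hπne : ∀ x, x ≠ i → π x ≠ x₀ := by
      intro x hx heq
      apply hx
      apply π.injective
      rw [heq, hπi]
    have hγS : ∀ x ∈ ({i} : Finset (Fin N)), (γ ∘ π) x = ((2 : ℕ) : ℚ)⁻¹ := by
      intro x hx
      rw [Finset.mem_singleton] at hx
      rw [hx, Function.comp_apply, hπi, hγx₀, Nat.cast_two]
    have hγle : ∀ x ∉ ({i} : Finset (Fin N)), (γ ∘ π) x ≤ (((2 : ℕ) : ℚ) * ((3 : ℚ) / 2))⁻¹ := by
      intro x hx
      rw [Finset.mem_singleton] at hx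
      rw [hpδ, Function.comp_apply]
      exact hothers _ (hπne x hx)
    have hbound := hironakaTau_deltaInitial_le_of_forall_natCast_ne hord hτ hFS hprep hδ hδint h' hγS hγle
    rw [hτδ, Finset.card_singleton, hpδ] at hbound
    have hcnt : 4 ≤ (exps (γ ∘ π)).countP (fun x => decide (x ≤ (3 : ℚ))) := by
      rw [countP_exps]
      have hstep := one_add_card_le_card_filter' (N := N) (γ := γ ∘ π) (i := i) (P := 2) (M := 3) (by norm_num)
        (by norm_num) (by norm_num) (by rw [Function.comp_apply, hπi, hγx₀])
      omega
    rw [exps_comp_perm, hes, Nat.cast_two, List.countP_cons_of_pos (by norm_num),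
      List.countP_cons_of_pos (by simp)] at hcnt
    obtain ⟨e₃, es₃, rfl⟩ : ∃ e₃ es₃, es' = e₃ :: es₃ := by
      cases es' with
      | nil => simp at hcnt
      | cons e₃ es₃ => exact ⟨e₃, es₃, rfl⟩
    have hs₃ : (e₃ :: es₃).Pairwise (· ≤ ·) := (List.pairwise_cons.1 hs₂).2
    have he₃ : e₃ ≤ 3 := head_le_of_countP_pos' hs₃ (by omega)
    have hcnt' : 1 ≤ es₃.countP (fun x => decide (x ≤ (3 : ℚ))) := by
      have := List.countP_cons (p := fun x => decide (x ≤ (3 : ℚ))) (a := e₃) (l := es₃)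
      have hle1 : (if decide (e₃ ≤ (3 : ℚ)) = true then 1 else 0) ≤ 1 := by split_ifs <;> omega
      omega
    obtain ⟨e₄, es₄, rfl⟩ : ∃ e₄ es₄, es₃ = e₄ :: es₄ := by
      cases es₃ with
      | nil => simp at hcnt'
      | cons e₄ es₄ => exact ⟨e₄, es₄, rfl⟩
    have hs₄ : (e₄ :: es₄).Pairwise (· ≤ ·) := (List.pairwise_cons.1 hs₃).2
    have he₄ : e₄ ≤ 3 := head_le_of_countP_pos' hs₄ (by omega)
    exact not_lt_quad_of_le he₃ he₄
  · push Not at hle'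
    obtain ⟨x, hx⟩ := hle'
    rw [Nat.cast_two] at hx
    have hγx : γ x ≠ 0 := (lt_trans (by norm_num) hx).ne'
    have hlt : (γ x)⁻¹ < 2 := inv_lt_of_inv_lt₀ (by norm_num) hx
    have hmem := inv_mem_exps_of_ne_zero' hγx
    obtain ⟨a, es, hes⟩ : ∃ a es, exps γ = a :: es := by
      cases hq' : exps γ with
      | nil => rw [hq'] at hmem; simp at hmem
      | cons a es => exact ⟨a, es, rfl⟩
    rw [hes] at hmem hsorted ⊢
    have ha : a < 2 := (le_of_mem_of_pairwise' hsorted hmem).trans_lt hlt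
    rw [ATW.TruncLex.cons_lt_cons]
    rintro (h1 | ⟨h2, -⟩)
    · exact lt_asymm ha h1
    · exact ha.ne' h2

end Three

end Literature.AlgebraicGeometry.Resolution.WeightedBlowup
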